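import Summits.AnomalousDissipation.AnomalousDissipation.Theorems.SolenoidalFractalHomogenisationLagrangianStepOneLevelSplitDefsW7
import Summits.AnomalousDissipation.AnomalousDissipation.Theorems.SolenoidalFractalHomogenisationLagrangianStepHighLabelDecayFrameDefs
import HarnessLib

/-!
# K1L_D (stmt-AnomalousDissipation-27980), (ℓ3) (D-TH)₀ — the PER-CLASS frozen-frame W7 form `ClassDecayWθ G₀ … adm` (definitions + glue)
# (Summits-side definitions file; review lane; `--supports stmt-AnomalousDissipation-27980 --as helper`)

Port plan B4 (`HOME/ad-sawtooth-k1loc-p1/g16/W7thg-portplan-k1locp1g16.md`; prover ad-sawtooth-k1loc-p1 g16; RULINGS D28-19/19′).  The flat W7 engine's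
native output is the PER-CLASS clause `ClassDecayW W M hM lo hi Λ β ν₀ Kb CK cK adm` (`…OneLevelSplitDefsW7`, p5 g9 text): data on ONE conjugate pair of Bloch
classes, admissibility predicate `adm` (near / far / all classes), splice `classDecayW_split`, then `ClassReduction` superposes the classes into `HighLabelDecayW`.
The frozen-frame port delivers the same per-class statement AT A FIXED CONSTANT FRAME `G₀`: this file is `ClassDecayW` VERBATIM except (exactly as in the
graded clause `HighLabelDecayWthg`, p726018): the datum is `H¹ ∧ zero-mean ∧ G₀-SOLENOIDAL` (`IsWeaklyDivFree (distort (fun _ => G₀) F)`) and the solution class is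
`IsWeakTensorPassiveVectorDistortedOn … (fun _ _ => G₀)`.  The ball quantifier `∀ θ ≤ θW, ∀ G₀, det = 1, |G₀ − 1| ≤ θ` is NOT inside: the engine proves
`ClassDecayWθ G₀ …` uniformly for every `G₀` of the ball (constants from the `(1 ± 3θ)²` slack), and the class reduction (B12) assembles `HighLabelDecayWthg`.
* `ClassDecayWθ G₀ W M hM lo hi Λ β ν₀ Kb CK cK adm`; `classDecayWθ_mono`, `classDecayWθ_split` (near ∪ far = all; copies of the flat glue);
* rung `classDecayWθ_one_iff : ClassDecayWθ 1 … adm ↔ ClassDecayW … adm` (`distort_one`, `toDistorted_one` / `of_one_toFlat`).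
Definitions + glue only; NOT a proof of `stub_W7thg`, of any block, of K1L_D or of AD; rung F-D1.A0.
[cite: BedrossianCotiZelati2017, Thm 1.1 (enhanced dissipation in shear flows) — the mechanism; the clause is this route's hypothesis (per-class graded W7)] [problem: turb]
-/

set_option linter.dupNamespace false

namespace Summit.AnomalousDissipation.AnomalousDissipation.Theorems.SolenoidalFractalHomogenisation.LagrangianStep

open Literature.Analysis Literature.Analysis.FluidPDE Literature.Analysis.FunctionSpaces
open MeasureTheory Set
open scoped InnerProductSpace
open Summit.AnomalousDissipation.AnomalousDissipation.Theorems

noncomputable section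

/-- **PER-CLASS frozen-frame high-label decay** at the CONSTANT frame `G₀`, with an admissibility predicate `adm n ν ℓ` on the Bloch class `ℓ + nℤ³`
(`admAll` / `admCompact R₁` / `admLarge R₁` of `…OneLevelSplitDefsW7`).  Same binders and conclusion as `ClassDecayW`, the datum being `H¹`, zero-mean and
`G₀`-SOLENOIDAL with modes only on the conjugate pair `(ℓ + nℤ³) ∪ (−ℓ + nℤ³)` at distance `≥ L` from the lattice, and the solution a weak solution of the
FROZEN-FRAME distorted cell problem (drift `cellField W M hM ν n`, tensor `(1/n²)𝔸`, constant distortion `G₀`).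
[cite: BedrossianCotiZelati2017, Thm 1.1 (enhanced dissipation in shear flows) — the mechanism; the clause itself is this route's hypothesis (per-class graded W7), text p1 g16] -/
def ClassDecayWθ (G₀ : Matrix (Fin 3) (Fin 3) ℝ) {k : ℕ} (W : LatticeShear.LatticeWord k) (M : ℝ) (hM : 0 < M) (lo hi Λ β ν₀ Kb CK cK : ℝ)
    (adm : ℕ → ℝ → (Fin 3 → ℤ) → Prop) : Prop :=
  ∀ ν, ∀ hν : ν ∈ Set.Ioo 0 ν₀, ∀ n : ℕ, 1 ≤ n → ∀ 𝔸 : Torus.Visc4 (Fin 3),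
    Torus.OddSmall 𝔸 (ν * β) → (∃ lam ∈ Set.Icc (1:ℝ) Λ, Torus.NearIso 𝔸 (ν * (lo / lam)) (ν * (hi * lam))) →
    ∀ L > (0:ℝ), (n : ℝ) * ν ≤ Kb * L →
    ∀ ℓ : Fin 3 → ℤ, (∀ z : Fin 3 → ℤ, L ≤ ‖Torus.latticeVec (ℓ + (n : ℤ) • z)‖) → adm n ν ℓ →
    ∀ F : VF, FunctionSpaces.Torus.MemSobolev 1 (FunctionSpaces.EuclideanSpace.complexify ∘ F) → FunctionSpaces.Torus.HasZeroMean F →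
      FunctionSpaces.Torus.IsWeaklyDivFree (Torus.distort (fun _ => G₀) F) →
      (∀ k' : Fin 3 → ℤ, (¬ ∃ z : Fin 3 → ℤ, k' = ℓ + (n : ℤ) • z) → (¬ ∃ z : Fin 3 → ℤ, k' = -ℓ + (n : ℤ) • z) →
        ∀ i, modeCoeff k' F i = 0) →
      ∀ T > (0:ℝ), ∀ u : ℝ → VF,
        Torus.IsWeakTensorPassiveVectorDistortedOn 0 T ((1 / (n:ℝ) ^ 2) • 𝔸) (cellField W M hM ν hν.1 n) (fun _ _ => G₀) F u →
        ∀ᵐ t ∂(volume.restrict (Ioo 0 T)),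
          ∫ x, ‖u t x‖ ^ 2 ≤ CK * Real.exp (-(2 * cK * ν * t)) * ∫ x, ‖F x‖ ^ 2

/-- Monotonicity of `ClassDecayWθ` in `(CK, cK, ν₀)` and in the admissibility predicate (copy of `classDecayW_mono`). -/
theorem classDecayWθ_mono {G₀ : Matrix (Fin 3) (Fin 3) ℝ} {k : ℕ} {W : LatticeShear.LatticeWord k} {M : ℝ} {hM : 0 < M}
    {lo hi Λ β ν₀ ν₀' Kb CK CK' cK cK' : ℝ} {adm adm' : ℕ → ℝ → (Fin 3 → ℤ) → Prop} (hν₀ : ν₀' ≤ ν₀) (hCK : CK ≤ CK') (hcK : cK' ≤ cK) (hCK0 : 0 ≤ CK')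
    (hadm : ∀ n ν ℓ, adm' n ν ℓ → adm n ν ℓ) (h : ClassDecayWθ G₀ W M hM lo hi Λ β ν₀ Kb CK cK adm) :
    ClassDecayWθ G₀ W M hM lo hi Λ β ν₀' Kb CK' cK' adm' := by
  intro ν hν n hn 𝔸 hodd hwin L hL hKL ℓ hdist hadm' F hF1 hF2 hF3 hsupp T hT u hu
  have hν' : ν ∈ Set.Ioo 0 ν₀ := ⟨hν.1, lt_of_lt_of_le hν.2 hν₀⟩
  have hX : 0 ≤ ∫ x, ‖F x‖ ^ 2 := integral_nonneg fun x => by positivity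
  filter_upwards [h ν hν' n hn 𝔸 hodd hwin L hL hKL ℓ hdist (hadm n ν ℓ hadm') F hF1 hF2 hF3 hsupp T hT u hu,
    ae_restrict_mem measurableSet_Ioo] with t ht htI
  exact ht.trans (profile_mono hCK hcK hCK0 hν.1.le htI.1.le hX)

/-- SPLICE at a fixed frame: near classes + far classes (same `R₁`) give all classes, constants `max CK`, `min cK`, `min ν₀` (copy of `classDecayW_split`). -/
theorem classDecayWθ_split {G₀ : Matrix (Fin 3) (Fin 3) ℝ} {k : ℕ} {W : LatticeShear.LatticeWord k} {M : ℝ} {hM : 0 < M}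
    {lo hi Λ β ν₁ ν₂ Kb CK₁ CK₂ cK₁ cK₂ : ℝ} (R₁ : ℝ) (hCK₁ : 0 ≤ CK₁)
    (h₁ : ClassDecayWθ G₀ W M hM lo hi Λ β ν₁ Kb CK₁ cK₁ (admCompact R₁))
    (h₂ : ClassDecayWθ G₀ W M hM lo hi Λ β ν₂ Kb CK₂ cK₂ (admLarge R₁)) :
    ClassDecayWθ G₀ W M hM lo hi Λ β (min ν₁ ν₂) Kb (max CK₁ CK₂) (min cK₁ cK₂) admAll := by
  intro ν hν n hn 𝔸 hodd hwin L hL hKL ℓ hdist _ F hF1 hF2 hF3 hsupp T hT u hu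
  have hCK0 : 0 ≤ max CK₁ CK₂ := le_max_of_le_left hCK₁
  by_cases hc : ∃ z : Fin 3 → ℤ, ‖Torus.latticeVec (ℓ + (n : ℤ) • z)‖ ≤ R₁ * n * ν
  · have h₁' := classDecayWθ_mono (adm' := admCompact R₁) (min_le_left ν₁ ν₂) (le_max_left CK₁ CK₂) (min_le_left cK₁ cK₂) hCK0
      (fun _ _ _ h => h) h₁
    exact h₁' ν hν n hn 𝔸 hodd hwin L hL hKL ℓ hdist hc F hF1 hF2 hF3 hsupp T hT u hu
  · have hfar : admLarge R₁ n ν ℓ := by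
      intro z
      by_contra hz
      exact hc ⟨z, (not_le.mp hz).le⟩
    have h₂' := classDecayWθ_mono (adm' := admLarge R₁) (min_le_right ν₁ ν₂) (le_max_right CK₁ CK₂) (min_le_right cK₁ cK₂) hCK0
      (fun _ _ _ h => h) h₂
    exact h₂' ν hν n hn 𝔸 hodd hwin L hL hKL ℓ hdist hfar F hF1 hF2 hF3 hsupp T hT u hu

/-- **Rung**: at the identity frame the per-class frozen clause IS the flat per-class clause. -/
theorem classDecayWθ_one_iff {k : ℕ} {W : LatticeShear.LatticeWord k} {M : ℝ} {hM : 0 < M} {lo hi Λ β ν₀ Kb CK cK : ℝ}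
    {adm : ℕ → ℝ → (Fin 3 → ℤ) → Prop} :
    ClassDecayWθ 1 W M hM lo hi Λ β ν₀ Kb CK cK adm ↔ ClassDecayW W M hM lo hi Λ β ν₀ Kb CK cK adm := by
  constructor
  · intro h ν hν n hn 𝔸 hodd hwin L hL hKL ℓ hdist hadm F hF hsupp T hT u hu
    have hdiv : FunctionSpaces.Torus.IsWeaklyDivFree (Torus.distort (fun _ => (1 : Matrix (Fin 3) (Fin 3) ℝ)) F) := by
      rw [Torus.distort_one]; exact hF.2.2
    have hF2 : MemLp F 2 volume := RealisedQuasiStaticCellLaw.memLp_two_of_memSobolev_one_complexify hF.1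
    exact h ν hν n hn 𝔸 hodd hwin L hL hKL ℓ hdist hadm F hF.1 hF.2.1 hdiv hsupp T hT u (hu.toDistorted_one hF2)
  · intro h ν hν n hn 𝔸 hodd hwin L hL hKL ℓ hdist hadm F hF1 hF2 hF3 hsupp T hT u hu
    have hF3' : FunctionSpaces.Torus.IsWeaklyDivFree F := by rwa [Torus.distort_one] at hF3
    have hu' : Torus.IsWeakTensorPassiveVectorOn 0 T ((1 / (n:ℝ) ^ 2) • 𝔸) (cellField W M hM ν hν.1 n) F u :=
      Torus.IsWeakTensorPassiveVectorDistortedOn.of_one_toFlat (by simpa using hu)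
    exact h ν hν n hn 𝔸 hodd hwin L hL hKL ℓ hdist hadm F ⟨hF1, hF2, hF3'⟩ hsupp T hT u hu'

end

end Summit.AnomalousDissipation.AnomalousDissipation.Theorems.SolenoidalFractalHomogenisation.LagrangianStep
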